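import Summits.ResolutionOfSingularities.ResolutionOfSingularities.Theorems.HilbertSamuelEliminationCampaignW42TertiaryCycles
import Summits.ResolutionOfSingularities.ResolutionOfSingularities.Theorems.HilbertSamuelEliminationSigmaMaxModificationsStubCentreSeqPackage
import Literature.AlgebraicGeometry.Resolution.SurfaceResolutionPermissibleCentres
import Literature.AlgebraicGeometry.Resolution.BirationalDimensionReduced
import Literature.AlgebraicGeometry.Resolution.RegularLocusDense
import Literature.AlgebraicGeometry.Resolution.ComponentGluing
import Literature.AlgebraicGeometry.Resolution.HilbertSamuelLowerBound
import Literature.AlgebraicGeometry.Resolution.NormalCrossingsStrictification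
import HarnessLib

/-!
# [OURS · L1 W4.2] O2 ⇒ the POINTED CORRIDOR case of Corridor3: for a reduced threefold whose maximal `ν`-stratum is
# ONE CLOSED POINT, `TertiaryTermination p` and CJS's resolution of excellent surfaces (Thm. 1.2, named fact) give the
# `ν`-modification — the lower-dimensional input (H2) discharged in dimension three
# (`--supports stmt-ResolutionOfSingularities-17846`; calibration against stmt-…-19249)

OURS (slot W4.2 of cell res-hironaka, LADDER-RESOLUTION rung L, D-0089; prover seat res-L1-s42-pv-2, gen 2); NOT
statements of H. Hironaka's manuscript [Hironaka2017]; nothing of the manuscript is used or asserted. AI review is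
weaker than expert review. Pure PROOF file; no new definition (the oracle is produced by an existence theorem).

The Cycles file (p485148) left exactly two inputs to `TameWild.NuMod X N d ν` at an isolated maximal stratum: O2
(`TertiaryTermination p`) and (H2) «the oracle answers on the reduced closed non-empty subsets of the `ν`-strata met
along `S(X, ν)`» — the lower-dimensional canonical resolution sequences (induction on dimension). Here (H2) is
DISCHARGED IN DIMENSION THREE from the printed resolution of excellent surfaces:

* `exists_choiceOracle` — AN ADMISSIBLE FUNCTIONAL ORACLE BY CHOICE: `R S t :↔ t` is THE chosen permissible blow-up
  sequence of `S` with centres over `S ∖ Reg S` and regular last stage, whenever one exists; it answers on every `S`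
  that has one. (The universally quantified `TertiaryTermination p` applies to it; nothing canonical is claimed.)
* `subset_compl_regularLocus_of_subset_hsStratum` — a `ν`-stratum with `ν ≠ Φ^{(N)}` (`dim ≤ N`) lies in the
  NON-REGULAR locus (CJS Lemma 2.31, tree `Scheme.hsFun_eq_iterPSum_Phi_iff`).
* `topologicalKrullDim_le_two_of_subset_hsStratum` — hence, on a reduced stage of dimension `≤ 3`, every closed
  subset of the `ν`-stratum has dimension `≤ 2` (regular locus dense, tree `Scheme.dense_regularLocus`; dimension drop
  along a closed nowhere dense subset, tree `topologicalKrullDim_lt_of_isClosed_of_dense_compl`).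
* `answers_of_dim_le_three` — (H2) FOR THREEFOLDS: along every canonical run from an isolated origin of a reduced `X/k`
  with `dim X ≤ 3`, the reduced closed non-empty subsets of the `ν`-strata are reduced excellent Noetherian schemes of
  dimension `≤ 2`, so CJS Thm. 1.2 (`CossartJannsenSaito2020SequencePermissible`, res-lit-6 p478780, F-32c) resolves
  them and the choice oracle answers.
* HEADLINE `nuMod_pointedThreefold_of_tertiaryTermination` — for every prime `p`: `TertiaryTermination p` and
  `CossartJannsenSaito2020SequencePermissible` give `TameWild.NuMod X N d ν` for every reduced separated `X` of finite
  type over a field of characteristic `p` with `dim X ≤ 3`, `dim X ≤ N`, `dim X ≤ d`, every maximal `ν ≠ Φ^{(N)}` whose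
  stratum `X(ν)` is ONE CLOSED POINT — wherever that point sits with respect to `Sing X` (the POINTED CORRIDOR case of
  `SigmaMaxModificationsCorridor3`, complementary to `TameWild.stub_isolatedNu3`, p459425, which needs `X(ν)` isolated
  FROM THE OTHER SINGULARITIES and Cossart–Piltant 2019). `nuMod_pointedThreefold_of_noNearChain`: the pointwise
  ∃-oracle form (no infinite near chain for ONE answering admissible oracle suffices).

HONEST STATUS: conditional on the named fact `CossartJannsenSaito2020SequencePermissible` (CJS LNM 2270 Thm. 1.2 as
printed minus canonicity; undischarged — Chs. 7–17 of the monograph) and on O2 (`TertiaryTermination p`, OPEN); both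
enter as hypotheses. Positive-dimensional maximal strata (the general corridor) are NOT treated: the compactness step
of the Campaign files is stated at isolated origins `X(ν) = {x}`.

## References

* V. Cossart, U. Jannsen, S. Saito, LNM 2270 (2020), Thm. 1.2 p. 5, Lemma 2.31, Def. 6.14, Rem. 6.29 (1), p. 107.
  [CossartJannsenSaito2020]
* route file Theses/HilbertSamuelElimination.lean (stmt-…-19249 `SigmaMaxModificationsCorridor3`);
  L/res-L1-w42-lead-1/tame_wild_current.lean (`stub_isolatedNu3`, `stub_confinedWildNu3`).
-/

noncomputable section

set_option linter.dupNamespace false -- mandated namespace of this single-conjunct summit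

open CategoryTheory AlgebraicGeometry TopologicalSpace Topology IsLocalRing

namespace Summit.ResolutionOfSingularities.ResolutionOfSingularities.Theorems

namespace CampaignW42

open Literature.AlgebraicGeometry.Resolution Literature.RingTheory.HilbertSamuel
open Summit.ResolutionOfSingularities.ResolutionOfSingularities.Theorems.SigmaMaxModificationsCorridor3

universe u

/-! ## An admissible functional oracle by choice -/

/-- **AN ADMISSIBLE FUNCTIONAL ORACLE BY CHOICE.** There is an oracle `R` which is functional and admissible
(`OracleFunctional`, `OracleAdmissible`) and which ANSWERS on every scheme admitting a blow-up sequence in permissible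
centres over its non-regular locus with regular last stage: `R S t` iff `t` is the chosen such sequence. [folklore] -/
theorem exists_choiceOracle :
    ∃ R : ∀ S : Scheme.{u}, CentreSeq S → Prop, OracleFunctional R ∧ OracleAdmissible R ∧
      ∀ S : Scheme.{u}, (∃ t : CentreSeq S, t.AllPermissible ∧ t.CentresOver (Scheme.regularLocus S)ᶜ ∧
        Literature.AlgebraicGeometry.Resolution.Scheme.IsRegular t.top) → ∃ t, R S t := by
  classical
  refine ⟨fun S t => ∃ h : (∃ t' : CentreSeq S, t'.AllPermissible ∧ t'.CentresOver (Scheme.regularLocus S)ᶜ ∧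
      Literature.AlgebraicGeometry.Resolution.Scheme.IsRegular t'.top), t = Classical.choose h, ?_, ?_, ?_⟩
  · rintro S t₁ t₂ ⟨h₁, rfl⟩ ⟨h₂, rfl⟩
    rfl
  · rintro S t ⟨h, rfl⟩
    exact Classical.choose_spec h
  · intro S h
    exact ⟨_, h, rfl⟩

/-! ## Strata of `ν ≠ Φ^{(N)}` are singular and of smaller dimension -/

/-- **A `ν`-stratum with `ν ≠ Φ^{(N)}` lies in the non-regular locus** (`dim W ≤ N`; CJS Lemma 2.31: at a regular point
with `dim 𝒪 ≤ N`, `H^N = Φ^{(N)}`). [cite: CossartJannsenSaito2020, Lemma 2.31] -/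
theorem subset_compl_regularLocus_of_subset_hsStratum {W : Scheme.{u}} [IsLocallyNoetherian W] {N : ℕ}
    {ν : ℕ → ℕ} (hν : ν ≠ iterPSum N Phi) (hdim : topologicalKrullDim W ≤ (N : WithBot ℕ∞)) {Z : Set W}
    (hZ : Z ⊆ Scheme.hsStratum W N ν) : Z ⊆ (Scheme.regularLocus W)ᶜ := by
  intro z hz hreg
  have hd : ringKrullDim (W.presheaf.stalk z) ≤ N := (ringKrullDim_stalk_le_topologicalKrullDim W z).trans hdim
  have h := (Scheme.hsFun_eq_iterPSum_Phi_iff N z).mpr ⟨hreg, hd⟩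
  exact hν ((Scheme.mem_hsStratum_iff.mp (hZ hz)).symm.trans h)

/-- `a < n + 1 → a ≤ n` in `WithBot ℕ∞` for natural `n`. [folklore] -/
theorem withBotENat_le_of_lt_succ {a : WithBot ℕ∞} {n : ℕ} (h : a < ((n + 1 : ℕ) : WithBot ℕ∞)) :
    a ≤ (n : WithBot ℕ∞) := by
  induction a using WithBot.recBotCoe with
  | bot => exact bot_le
  | coe b =>
    induction b using ENat.recTopCoe with
    | top => exact absurd h (not_lt_of_ge (by exact_mod_cast le_top))
    | coe m =>
      have hm : (m : ℕ∞) < ((n + 1 : ℕ) : ℕ∞) := by exact_mod_cast h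
      have : m < n + 1 := by exact_mod_cast hm
      exact_mod_cast (show (m : ℕ∞) ≤ n by exact_mod_cast Nat.lt_succ_iff.mp this)

/-- **ON A REDUCED STAGE OF DIMENSION `≤ 3`, CLOSED SUBSETS OF A `ν`-STRATUM (`ν ≠ Φ^{(N)}`, `dim ≤ N`) HAVE DIMENSION
`≤ 2`**: they lie in the non-regular locus, the regular locus of a reduced scheme is dense, and a closed subset with
dense complement of a Noetherian sober space drops the dimension. [cite: CossartJannsenSaito2020, Lemma 2.31] -/
theorem topologicalKrullDim_le_two_of_subset_hsStratum {W : Scheme.{u}} [IsNoetherian W] [IsReduced W] {N : ℕ}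
    {ν : ℕ → ℕ} (hν : ν ≠ iterPSum N Phi) (hdimN : topologicalKrullDim W ≤ (N : WithBot ℕ∞))
    (hdim3 : topologicalKrullDim W ≤ ((3 : ℕ) : WithBot ℕ∞)) {Z : Set W} (hZc : IsClosed Z)
    (hZ : Z ⊆ Scheme.hsStratum W N ν) : topologicalKrullDim Z ≤ ((2 : ℕ) : WithBot ℕ∞) := by
  have hsing := subset_compl_regularLocus_of_subset_hsStratum hν hdimN hZ
  have hdense : Dense Zᶜ := (Scheme.dense_regularLocus W).mono (Set.subset_compl_comm.mp hsing)
  have hlt : topologicalKrullDim W < ((3 + 1 : ℕ) : WithBot ℕ∞) :=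
    lt_of_le_of_lt hdim3 (by exact_mod_cast Nat.lt_succ_self 3)
  exact withBotENat_le_of_lt_succ (topologicalKrullDim_lt_of_isClosed_of_dense_compl hZc hdense 3 hlt)

/-! ## (H2) for threefolds: the choice oracle answers along `S(X, ν)` -/

variable {p : ℕ} {R : ∀ S : Scheme.{u}, CentreSeq S → Prop} {N : ℕ} {ν : ℕ → ℕ}

/-- **(H2) IN DIMENSION THREE.** At an isolated origin of a reduced `X/k` with `dim X ≤ 3` and `ν ≠ Φ^{(N)}`, for an
admissible oracle which answers on every scheme admitting a permissible resolution sequence: along every canonical run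
`s` of `S(X, ν)`, the reduced closed subscheme on a closed non-empty `Z ⊆ X_s(ν)` is a reduced excellent Noetherian
scheme of dimension `≤ 2` (stages stay of finite type over `k`, reduced, of dimension `≤ 3`, with `ν` never exceeded:
`StateGood` propagation, p477843, and `stateGood_init`, p485148), so CJS Thm. 1.2 resolves it and the oracle answers.
[cite: CossartJannsenSaito2020, Thm. 1.2 (p. 5), Rem. 6.29 (1)] -/
theorem answers_of_dim_le_three (hCJS : CossartJannsenSaito2020SequencePermissible.{u}) (hRa : OracleAdmissible R)
    (hRtot : ∀ S : Scheme.{u}, (∃ t : CentreSeq S, t.AllPermissible ∧ t.CentresOver (Scheme.regularLocus S)ᶜ ∧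
      Literature.AlgebraicGeometry.Resolution.Scheme.IsRegular t.top) → ∃ t, R S t)
    {X : Scheme.{u}} [IsLocallyNoetherian X] {x : X} (hX : IsIsolatedOrigin p N ν X x) (hν : ν ≠ iterPSum N Phi)
    (hdim3 : topologicalKrullDim X ≤ ((3 : ℕ) : WithBot ℕ∞)) (s : CentreSeq X) (hs : s.IsCanonicalRun R N ν)
    (Z : Set s.top) (hZ : IsClosed Z) (hZν : Z ⊆ Scheme.hsStratum s.top N ν) (_hne : Z.Nonempty) :
    ∃ t, R (Scheme.IdealSheafData.vanishingIdeal ⟨Z, hZ⟩).subscheme t := by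
  obtain ⟨k, _, _, f, -, hft, hqc⟩ := hX.exists_structure
  haveI := hft
  haveI := hqc
  haveI : IsReduced X := hX.isReduced
  have hgood : StateGood k R N ν X (Labelling.init X) none := stateGood_init hRa hX hν f
  obtain ⟨L', P', hg'⟩ := exists_stateGood_top_of_run s.length hgood s hs rfl
  obtain ⟨g, hgft, hgqc⟩ := hg'.overField
  haveI := hgft
  haveI := hgqc
  haveI : IsLocallyNoetherian s.top := hg'.isLocallyNoetherian
  haveI : IsNoetherian s.top := hg'.isNoetherian
  haveI : IsReduced s.top := SigmaMaxModifications.Sketch.isReduced_top s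
  have hdim3' : topologicalKrullDim s.top ≤ ((3 : ℕ) : WithBot ℕ∞) := CentreSeq.topologicalKrullDim_top_le s hdim3
  -- the reduced closed subscheme on `Z`
  set T := (Scheme.IdealSheafData.vanishingIdeal ⟨Z, hZ⟩ : s.top.IdealSheafData) with hT
  haveI : IsReduced T.subscheme := ComponentGluing.isReduced_subscheme_vanishingIdeal ⟨Z, hZ⟩
  haveI : IsNoetherian T.subscheme := Scheme.isNoetherian_of_finiteType_over_field (T.subschemeι ≫ g)
  have hexcT : Scheme.IsExcellent T.subscheme :=
    Scheme.isExcellent_of_locallyOfFiniteType Stacks07QW_field_holds (T.subschemeι ≫ g)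
  have hdimT : topologicalKrullDim T.subscheme ≤ 2 := by
    rw [hT, topologicalKrullDim_subscheme_vanishingIdeal]
    exact_mod_cast topologicalKrullDim_le_two_of_subset_hsStratum hν hg'.dim_le hdim3' hZ hZν
  obtain ⟨t, hperm, hsing, hreg⟩ := hCJS T.subscheme hexcT hdimT
  exact hRtot _ ⟨t, hperm, hsing.centresOver, hreg⟩

/-! ## The pointed corridor case of Corridor3, modulo O2 -/

/-- **O2 ⇒ THE POINTED CORRIDOR CASE OF CORRIDOR3.** For every prime `p`: `TertiaryTermination p` (OURS O2 statement)
and `CossartJannsenSaito2020SequencePermissible` (CJS Thm. 1.2, named fact) give a `ν`-MODIFICATION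
`TameWild.NuMod X N d ν` of every reduced separated `X` of finite type over a field `k` of characteristic `p` with
`dim X ≤ 3`, `dim X ≤ N`, `dim X ≤ d`, at every MAXIMAL value `ν ≠ Φ^{(N)}` whose stratum is ONE CLOSED POINT,
`X(ν) = {x}` — wherever `x` sits with respect to the rest of `Sing X` (pointed corridor; `stub_isolatedNu3` needs
`X(ν)` isolated from `Sing X ∖ X(ν)`). The `ν`-modification is the canonical sequence `S(X, ν)` of CJS Rem. 6.29 (1)
run with the choice oracle on the lower-dimensional strata. [cite: CossartJannsenSaito2020, Thm. 1.2, Def. 6.14, Rem. 6.29 (1), p. 107] -/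
theorem nuMod_pointedThreefold_of_tertiaryTermination {p : ℕ} (h : TertiaryTermination.{0} p)
    (hCJS : CossartJannsenSaito2020SequencePermissible.{0}) {k : Type} [Field k] [CharP k p] {X : Scheme.{0}}
    (f : X ⟶ Spec (.of k)) [IsSeparated f] [LocallyOfFiniteType f] [QuasiCompact f] [IsReduced X]
    (hdim3 : topologicalKrullDim X ≤ ((3 : ℕ) : WithBot ℕ∞)) {N : ℕ}
    (hdimN : topologicalKrullDim X ≤ (N : WithBot ℕ∞)) {d : ℕ} (hdimd : topologicalKrullDim X ≤ (d : WithBot ℕ∞))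
    {ν : ℕ → ℕ} (hν : Maximal (· ∈ Scheme.hsValues X N) ν) (hνΦ : ν ≠ iterPSum N Phi) {x : X}
    (hx : IsClosed ({x} : Set X)) (hstr : Scheme.hsStratum X N ν = {x}) : TameWild.NuMod X N d ν := by
  haveI : IsLocallyNoetherian X := LocallyOfFiniteType.isLocallyNoetherian f
  have hX : IsIsolatedOrigin p N ν X x := ⟨⟨k, ‹_›, ‹_›, f, ‹_›, ‹_›, ‹_›⟩, ‹_›, hdimN, hν, hx, hstr⟩
  obtain ⟨R, hRf, hRa, hRtot⟩ := exists_choiceOracle.{0}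
  exact nuMod_isolated_of_tertiaryTermination h hRf hRa hX hdimd hνΦ
    (fun s hs Z hZ hZν hne => answers_of_dim_le_three hCJS hRa hRtot hX hνΦ hdim3 s hs Z hZ hZν hne)

/-- **The pointwise ∃-oracle form:** for ANY functional admissible oracle answering on every scheme that admits a
permissible resolution sequence (e.g. the choice oracle), NO INFINITE NEAR CHAIN from `(X, x)` — O2 at this one origin
for this one oracle — and CJS Thm. 1.2 give `TameWild.NuMod X N d ν` (same scope as above).
[cite: CossartJannsenSaito2020, Thm. 1.2, Def. 6.14, Rem. 6.29 (1)] -/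
theorem nuMod_pointedThreefold_of_noNearChain {p : ℕ} (hCJS : CossartJannsenSaito2020SequencePermissible.{0})
    {R : ∀ S : Scheme.{0}, CentreSeq S → Prop} (hRf : OracleFunctional R) (hRa : OracleAdmissible R)
    (hRtot : ∀ S : Scheme.{0}, (∃ t : CentreSeq S, t.AllPermissible ∧ t.CentresOver (Scheme.regularLocus S)ᶜ ∧
      Literature.AlgebraicGeometry.Resolution.Scheme.IsRegular t.top) → ∃ t, R S t)
    {k : Type} [Field k] [CharP k p] {X : Scheme.{0}} [IsLocallyNoetherian X] (f : X ⟶ Spec (.of k))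
    [IsSeparated f] [LocallyOfFiniteType f] [QuasiCompact f] [IsReduced X]
    (hdim3 : topologicalKrullDim X ≤ ((3 : ℕ) : WithBot ℕ∞))
    {N : ℕ} (hdimN : topologicalKrullDim X ≤ (N : WithBot ℕ∞)) {d : ℕ}
    (hdimd : topologicalKrullDim X ≤ (d : WithBot ℕ∞)) {ν : ℕ → ℕ} (hν : Maximal (· ∈ Scheme.hsValues X N) ν)
    (hνΦ : ν ≠ iterPSum N Phi) {x : X} (hx : IsClosed ({x} : Set X)) (hstr : Scheme.hsStratum X N ν = {x})
    (hno : NoNearChainFrom R N ν (MarkedStage.init X x) fun _ => True) : TameWild.NuMod X N d ν := by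
  have hX : IsIsolatedOrigin p N ν X x := ⟨⟨k, ‹_›, ‹_›, f, ‹_›, ‹_›, ‹_›⟩, ‹_›, hdimN, hν, hx, hstr⟩
  exact nuMod_isolated_of_noNearChain hRf hRa hX hdimd hνΦ
    (fun s hs Z hZ hZν hne => answers_of_dim_le_three hCJS hRa hRtot hX hνΦ hdim3 s hs Z hZ hZν hne) hno

/-- **At such an origin, for an answering admissible functional oracle, O2 is exactly termination of `S(X, ν)`**
(dimension `≤ 3`, CJS Thm. 1.2): no infinite near chain ⟺ `S(X, ν)` terminates ⟺ not infinite.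
[cite: CossartJannsenSaito2020, Thm. 1.2, Rem. 6.29 (1), p. 107] -/
theorem noNearChain_iff_terminates_pointedThreefold (hCJS : CossartJannsenSaito2020SequencePermissible.{u})
    (hRf : OracleFunctional R) (hRa : OracleAdmissible R)
    (hRtot : ∀ S : Scheme.{u}, (∃ t : CentreSeq S, t.AllPermissible ∧ t.CentresOver (Scheme.regularLocus S)ᶜ ∧
      Literature.AlgebraicGeometry.Resolution.Scheme.IsRegular t.top) → ∃ t, R S t)
    {X : Scheme.{u}} [IsLocallyNoetherian X] {x : X} (hX : IsIsolatedOrigin p N ν X x) (hν : ν ≠ iterPSum N Phi)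
    (hdim3 : topologicalKrullDim X ≤ ((3 : ℕ) : WithBot ℕ∞)) :
    ((NoNearChainFrom R N ν (MarkedStage.init X x) fun _ => True) ↔ CanonicalSequenceTerminates R N ν X) ∧
      (CanonicalSequenceTerminates R N ν X ↔ ¬ CanonicalSequenceInfinite R N ν X) :=
  noNearChain_iff_terminates_isolated hRf hRa hX hν
    (fun s hs Z hZ hZν hne => answers_of_dim_le_three hCJS hRa hRtot hX hν hdim3 s hs Z hZ hZν hne)

end CampaignW42

end Summit.ResolutionOfSingularities.ResolutionOfSingularities.Theorems

end
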